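import Summits.QuantumFields.BalabanUV.Beta.GAN24.FibreRateTBlockRate
import Summits.QuantumFields.BalabanUV.Beta.GAN24.FibreRateFeedTerms
import Summits.QuantumFields.BalabanUV.Beta.GAN24.SourceSidePair
import Summits.QuantumFields.BalabanUV.Beta.GAN24.StripAliasBounds

/-!
# `BalabanUV.Beta.GAN24.FibreRateFeedFactors` — binder row G-an2-4 / (CONV-C), road P1-fibre, self-row **P1-Y11t\*** (alias-sum side of p1 row
# L11, division agreed with the L11 owner in CLAIMS l.3039/l.3094), part 7a: the MIXED-LEVEL READING FACTOR `mfac` — closed form, majorant, rate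

NOT IN PRINT; OUR PROOF ATTEMPT.  HONEST FRAMING (cell contract, verbatim): «discharging `BetaPertH` makes Bałaban's UV stability
UNCONDITIONAL — a real constructive-QFT result; it is NOT the continuum limit and NOT the Clay problem.»  HONEST DEPENDENCY (verbatim):
«continuum YM on T⁴ ⇐ BetaPertH ∧ nine spine estimates (0/9 proved); BetaPertH ⇐ (D1) ∧ (D4) ∧ CAP+tail; G-an2-4 gates asym, D1 and
NE2/3/4.»  [folklore] one-variable analysis over part 2's engine (`eK`, `wMaj`, `rf_sq_le_wMaj`, `abs_inv_eK_two_level_le_rel`) and part 6's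
`mfac/mfacS`, `SourceSidePair.gs_zero`, `StripAliasBounds.cexp_sub_one_mul_cexp_neg_sub_one` BY NAME; no def, NO cited fact, NO `def … : Prop`, NO wall binder.  NOT summit progress; nothing of (CONV-C)'s K-slot is discharged.

## What is proved (`N = M·Lc`, `M, Lc ≥ 1`, extended zone `|q| ≤ 5πN/3`)
`mfac N M 0 = M/N`; CLOSED FORM `mfac N M q = (e^{iq/Lc} − 1)(e^{−iq} − 1)/eK_N(q)` (`q ≠ 0`: both geometric sums telescope against
`e^{±iq/N} − 1`, whose product is `eK_N(q)/N²`); **`norm_mfac_le`**: `‖mfac‖ ≤ wMaj Lc q` (via `‖gs‖ = M·rf`, `rf² ≤ wMaj`, `wMaj 1 ≤ wMaj Lc`);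
**`norm_mfac_two_level_le`**: `‖mfac_{N·Lc,N}(q) − mfac_{N,M}(q)‖ ≤ (6q²/N²)·wMaj Lc q` (level-free numerator × King's relative reciprocal rate);
`mfacS = conj mfac` with the same bound and rate.  Consumers: part 7b `GAN24/FibreRateFeedSums`.
-/

noncomputable section

open Complex Finset
open scoped BigOperators Real ComplexConjugate
open Literature.Probability.LatticeModels (TorusSite)
open Literature.MathematicalPhysics.QuantumFieldTheory.King1986 (latticeSymbol momSq momSq_nonneg)
open Literature.MathematicalPhysics.QuantumFieldTheory.Balaban1983to89.B4Strip (ofRealVec)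
open Summit.QuantumFields.BalabanUV.Beta.GAN24.AliasObjects (gs conj_gs)
open Summit.QuantumFields.BalabanUV.Beta.GAN24.FibreRateTBlock (qlab rf rf_nonneg)
open Summit.QuantumFields.BalabanUV.Beta.GAN24.FibreRateTBlockRate
open Summit.QuantumFields.BalabanUV.Beta.GAN24.FibreRateFeedTerms

namespace Summit.QuantumFields.BalabanUV.Beta.GAN24.FibreRateFeedFactors

variable {D : ℕ}

/-! ## §1 The mixed reading factor -/

section Mfac

variable {N M Lc : ℕ}

/-- [folklore] `mfac N M 0 = M/N`. -/
theorem mfac_zero (N M : ℕ) : mfac N M 0 = (M : ℂ) / (N : ℂ) := by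
  unfold mfac
  rw [show ((0 / N : ℝ) : ℂ) = 0 by simp, neg_zero, SourceSidePair.gs_zero, SourceSidePair.gs_zero]
  rcases Nat.eq_zero_or_pos N with hN | hN
  · subst hN; simp
  · have hN' : (N : ℂ) ≠ 0 := Nat.cast_ne_zero.2 hN.ne'
    field_simp

/-- [folklore] **CLOSED FORM** `mfac N M q = (e^{iq/Lc} − 1)(e^{−iq} − 1)/eK_N(q)` for `N = M·Lc`, `q ≠ 0` on the extended zone. -/
theorem mfac_eq_div (hM : 0 < M) (hLc : 0 < Lc) (hNM : N = M * Lc) {q : ℝ} (hq : |q| ≤ 5 * π / 3 * (N : ℝ)) (hq0 : q ≠ 0) :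
    mfac N M q = (cexp (I * ((q / Lc : ℝ) : ℂ)) - 1) * (cexp (-(I * (q : ℂ))) - 1) / ((eK N q : ℝ) : ℂ) := by
  have hN : 0 < N := by rw [hNM]; exact Nat.mul_pos hM hLc
  have hN' : (0 : ℝ) < N := by exact_mod_cast hN
  have hNc : (N : ℂ) ≠ 0 := Nat.cast_ne_zero.2 hN.ne'
  have hLcc : (Lc : ℂ) ≠ 0 := Nat.cast_ne_zero.2 hLc.ne'
  have hNLc : (N : ℂ) = (M : ℂ) * Lc := by rw [hNM]; push_cast; ring
  have hMc : (M : ℂ) ≠ 0 := Nat.cast_ne_zero.2 hM.ne'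
  have he := eK_pos hN' hq hq0
  have hE : (cexp (I * ((q / N : ℝ) : ℂ)) - 1) * (cexp (-(I * ((q / N : ℝ) : ℂ))) - 1) = ((eK N q / (N : ℝ) ^ 2 : ℝ) : ℂ) := by
    rw [StripAliasBounds.cexp_sub_one_mul_cexp_neg_sub_one]
    congr 1
    unfold eK
    field_simp
  have hE0 : cexp (I * ((q / N : ℝ) : ℂ)) - 1 ≠ 0 := by
    intro h0
    have := hE
    rw [h0, zero_mul] at this
    have h2 : (eK N q / (N : ℝ) ^ 2 : ℝ) = 0 := by exact_mod_cast this.symm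
    rw [div_eq_zero_iff] at h2
    rcases h2 with h2 | h2
    · exact he.ne' h2
    · exact hN'.ne' (pow_eq_zero_iff (n := 2) (by norm_num) |>.1 h2)
  have hE0' : cexp (-(I * ((q / N : ℝ) : ℂ))) - 1 ≠ 0 := by
    intro h0
    have := hE
    rw [h0, mul_zero] at this
    have h2 : (eK N q / (N : ℝ) ^ 2 : ℝ) = 0 := by exact_mod_cast this.symm
    rw [div_eq_zero_iff] at h2
    rcases h2 with h2 | h2
    · exact he.ne' h2
    · exact hN'.ne' (pow_eq_zero_iff (n := 2) (by norm_num) |>.1 h2)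
  -- the two telescoping identities
  have h1 : gs ((q / N : ℝ) : ℂ) M * (cexp (I * ((q / N : ℝ) : ℂ)) - 1) = cexp (I * ((q / Lc : ℝ) : ℂ)) - 1 := by
    rw [gs, AliasWeights.geomExp_mul_sub_one]; congr 2; push_cast; rw [hNLc]; field_simp
  have h2 : gs (-((q / N : ℝ) : ℂ)) N * (cexp (-(I * ((q / N : ℝ) : ℂ))) - 1) = cexp (-(I * (q : ℂ))) - 1 := by
    have e1 : -(I * (((q / N : ℝ) : ℂ))) = I * (-(((q / N : ℝ) : ℂ))) := by ring
    rw [gs, e1, AliasWeights.geomExp_mul_sub_one]; congr 1; push_cast; field_simp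
  unfold mfac
  rw [eq_div_iff (by exact_mod_cast he.ne'), ← h1, ← h2]
  have hE' : ((eK N q : ℝ) : ℂ) = (N : ℂ) ^ 2 * ((cexp (I * ((q / N : ℝ) : ℂ)) - 1) * (cexp (-(I * ((q / N : ℝ) : ℂ))) - 1)) := by
    rw [hE]; push_cast; field_simp
  rw [hE']
  field_simp

/-- [folklore] `wMaj` is monotone in the ratio: `wMaj 1 q ≤ wMaj Lc q` (`Lc ≥ 1`). -/
theorem wMaj_one_le (hLc : 0 < Lc) (q : ℝ) : wMaj 1 q ≤ wMaj Lc q := by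
  unfold wMaj
  have hLc' : (1 : ℝ) ≤ Lc := by exact_mod_cast hLc
  have hm : (0 : ℝ) < max (q ^ 2) 1 := lt_of_lt_of_le one_pos (le_max_right _ _)
  refine min_le_min le_rfl ?_
  push_cast
  gcongr

/-- [folklore] **`‖mfac‖ ≤ wMaj Lc q`** (`N = M·Lc`, extended zone; all `q`). -/
theorem norm_mfac_le (hM : 0 < M) (hLc : 0 < Lc) (hNM : N = M * Lc) {q : ℝ} (hq : |q| ≤ 5 * π / 3 * (N : ℝ)) :
    ‖mfac N M q‖ ≤ wMaj Lc q := by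
  have hN : 0 < N := by rw [hNM]; exact Nat.mul_pos hM hLc
  have hNr : (0 : ℝ) < N := by exact_mod_cast hN
  have hMr : (0 : ℝ) < M := by exact_mod_cast hM
  have hMN : (M : ℝ) ≤ N := by exact_mod_cast (hNM ▸ Nat.le_mul_of_pos_right M hLc)
  -- ‖gs(q/N, M)‖ = M·rf_{N,M}, ‖gs(−q/N, N)‖ = N·rf_{N,N}
  have hconj : gs (-((q / N : ℝ) : ℂ)) N = conj (gs ((q / N : ℝ) : ℂ) N) := (conj_gs (Complex.conj_ofReal _) N).symm
  have h1 : ‖gs ((q / N : ℝ) : ℂ) M‖ = M * rf N M q := by unfold rf; field_simp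
  have h2 : ‖gs (-((q / N : ℝ) : ℂ)) N‖ = N * rf N N q := by rw [hconj, Complex.norm_conj]; unfold rf; field_simp
  have hr1 := rf_sq_le_wMaj hM hLc hNM hq
  have hr2 : rf N N q ^ 2 ≤ wMaj 1 q := rf_sq_le_wMaj hN one_pos (by simp) hq
  have hr2' := hr2.trans (wMaj_one_le hLc q)
  unfold mfac
  rw [norm_div, norm_mul, h1, h2, Complex.norm_pow, Complex.norm_natCast]
  have hrf1 := rf_nonneg N M q
  have hrf2 := rf_nonneg N N q
  calc M * rf N M q * (N * rf N N q) / (N : ℝ) ^ 2 = (M / N) * (rf N M q * rf N N q) := by field_simp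
    _ ≤ 1 * (rf N M q * rf N N q) := by gcongr; rw [div_le_one hNr]; exact hMN
    _ ≤ (rf N M q ^ 2 + rf N N q ^ 2) / 2 := by nlinarith [sq_nonneg (rf N M q - rf N N q)]
    _ ≤ (wMaj Lc q + wMaj Lc q) / 2 := by gcongr
    _ = wMaj Lc q := by ring

/-- [folklore] **TWO-LEVEL RATE** `‖mfac_{N·Lc,N}(q) − mfac_{N,M}(q)‖ ≤ (6q²/N²)·wMaj Lc q` (`N = M·Lc`, extended zone; all `q`). -/
theorem norm_mfac_two_level_le (hM : 0 < M) (hLc : 0 < Lc) (hNM : N = M * Lc) {q : ℝ} (hq : |q| ≤ 5 * π / 3 * (N : ℝ)) :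
    ‖mfac (N * Lc) N q - mfac N M q‖ ≤ 6 * q ^ 2 / (N : ℝ) ^ 2 * wMaj Lc q := by
  have hN : 0 < N := by rw [hNM]; exact Nat.mul_pos hM hLc
  have hN' : (0 : ℝ) < N := by exact_mod_cast hN
  rcases eq_or_ne q 0 with rfl | hq0
  · rw [mfac_zero, mfac_zero]
    have hNc : (N : ℂ) ≠ 0 := Nat.cast_ne_zero.2 hN.ne'
    have hLcc : (Lc : ℂ) ≠ 0 := Nat.cast_ne_zero.2 hLc.ne'
    have hMc : (M : ℂ) ≠ 0 := Nat.cast_ne_zero.2 hM.ne'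
    have e : (N : ℂ) / ((N * Lc : ℕ) : ℂ) - (M : ℂ) / (N : ℂ) = 0 := by rw [hNM]; push_cast; field_simp; ring
    rw [e]; simp
  have hNN' : (N : ℝ) ≤ ((N * Lc : ℕ) : ℝ) := by exact_mod_cast Nat.le_mul_of_pos_right N hLc
  have hq' : |q| ≤ 5 * π / 3 * ((N * Lc : ℕ) : ℝ) := zone_mono hNN' hq
  rw [mfac_eq_div hN hLc rfl hq' hq0, mfac_eq_div hM hLc hNM hq hq0]
  have e : ∀ a b c : ℂ, a / b - a / c = a * (b⁻¹ - c⁻¹) := fun a b c => by ring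
  rw [e, norm_mul]
  have hrel := abs_inv_eK_two_level_le_rel hN' hNN' hq hq0
  have he := eK_pos hN' hq hq0
  have hinv : ‖(((eK ((N * Lc : ℕ) : ℝ) q : ℝ) : ℂ))⁻¹ - (((eK N q : ℝ) : ℂ))⁻¹‖ = |(eK ((N * Lc : ℕ) : ℝ) q)⁻¹ - (eK N q)⁻¹| := by
    rw [← Complex.ofReal_inv, ← Complex.ofReal_inv, ← Complex.ofReal_sub, Complex.norm_real, Real.norm_eq_abs]
  rw [hinv]
  have hm := norm_mfac_le hM hLc hNM hq
  rw [mfac_eq_div hM hLc hNM hq hq0, norm_div, Complex.norm_real, Real.norm_eq_abs, abs_of_pos he] at hm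
  set A := ‖(cexp (I * ((q / Lc : ℝ) : ℂ)) - 1) * (cexp (-(I * (q : ℂ))) - 1)‖
  calc A * |(eK ((N * Lc : ℕ) : ℝ) q)⁻¹ - (eK N q)⁻¹| ≤ A * (6 * q ^ 2 / N ^ 2 * (eK N q)⁻¹) := mul_le_mul_of_nonneg_left hrel (norm_nonneg _)
    _ = 6 * q ^ 2 / N ^ 2 * (A / eK N q) := by rw [div_eq_mul_inv A]; ring
    _ ≤ 6 * q ^ 2 / N ^ 2 * wMaj Lc q := mul_le_mul_of_nonneg_left hm (by positivity)

/-- [folklore] `mfacS = conj mfac` (real `q`). -/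
theorem mfacS_eq_conj (N M : ℕ) (q : ℝ) : mfacS N M q = conj (mfac N M q) := by
  unfold mfac mfacS
  have h1 : conj (gs ((q / N : ℝ) : ℂ) M) = gs (-((q / N : ℝ) : ℂ)) M := conj_gs (Complex.conj_ofReal _) M
  have h2 : conj (gs (-((q / N : ℝ) : ℂ)) N) = gs ((q / N : ℝ) : ℂ) N := by
    rw [conj_gs (by rw [map_neg, Complex.conj_ofReal]) N, neg_neg]
  rw [map_div₀, map_mul, h1, h2, map_pow, map_natCast, mul_comm]

/-- [folklore] `‖mfacS‖ ≤ wMaj Lc q`. -/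
theorem norm_mfacS_le (hM : 0 < M) (hLc : 0 < Lc) (hNM : N = M * Lc) {q : ℝ} (hq : |q| ≤ 5 * π / 3 * (N : ℝ)) :
    ‖mfacS N M q‖ ≤ wMaj Lc q := by
  rw [mfacS_eq_conj, Complex.norm_conj]; exact norm_mfac_le hM hLc hNM hq

/-- [folklore] `‖mfacS_{N·Lc,N} − mfacS_{N,M}‖ ≤ (6q²/N²)·wMaj Lc q`. -/
theorem norm_mfacS_two_level_le (hM : 0 < M) (hLc : 0 < Lc) (hNM : N = M * Lc) {q : ℝ} (hq : |q| ≤ 5 * π / 3 * (N : ℝ)) :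
    ‖mfacS (N * Lc) N q - mfacS N M q‖ ≤ 6 * q ^ 2 / (N : ℝ) ^ 2 * wMaj Lc q := by
  rw [mfacS_eq_conj, mfacS_eq_conj, ← map_sub, Complex.norm_conj]; exact norm_mfac_two_level_le hM hLc hNM hq

end Mfac

end Summit.QuantumFields.BalabanUV.Beta.GAN24.FibreRateFeedFactors

end
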